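import Mathlib
import Literature.Combinatorics.StablePolynomials.RealRootedRestriction

/-!
# `DivisionGap.PerMultiplesHard` (stmt-ValiantsHypothesis-5068), line `uncharged-face-walk`:
stub `stub_realRootedRestriction` — restrictions of real stable polynomials to coordinate lines
are real-rooted

The line discharges the van der Waerden permanent bound by Gurvits' capacity argument on top of
the tree's stable-polynomial library; one step of that argument passes from a REAL STABLE
`q ∈ ℝ[z_0, …, z_{n-1}]` (`Literature.Combinatorics.StablePolynomials.IsRealStable q`: the
complexification has no zero in the open upper half-space `Hⁿ`) to the univariate restriction
`R(t) = q(x with xᵢ := t)` at a real point `x`, realised as the `Polynomial ℝ`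
`MvPolynomial.aeval (fun j => if j = i then X else C (x j)) q`, and needs: `R = 0` or every complex
root of `R` is real (Borcea–Brändén 2009, Lemma 1.7 (1); Wagner 2011, Lemma 2.4 (d)).

Proof.  This is the tree's
`Literature.Combinatorics.StablePolynomials.IsRealStable.aeval_line_eq_zero_or_im_eq_zero`
(any finite index type with decidable equality) at `σ = Fin n`: freeze the coordinates `j ≠ i` at
the real values `x j` in the stable complexification — `0` or stable, by the multivariate Hurwitz
theorem (`eq_zero_or_isUpperHalfPlaneStable_of_mem_closure`) since `ℝⁿ ⊆ closure Hⁿ` — and read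
off the roots: one with `Im t > 0` is the zero `(t, …, t) ∈ Hⁿ`, one with `Im t < 0` conjugates to
one (real coefficients). [cite: BorceaBranden2009, §1, Lemma 1.7 (1)]
-/

noncomputable section

-- `Summit.ValiantsHypothesis.ValiantsHypothesis.…` is the tree's mandated layout (Sub = Summit).
set_option linter.dupNamespace false

namespace Summit.ValiantsHypothesis.ValiantsHypothesis.Theorems.DivisionGap.PerMultiplesHard.RealRootedRestriction

/-- **stub_realRootedRestriction — restrictions of real stable polynomials to coordinate lines are
real-rooted.**  For a real stable `q ∈ ℝ[z_0, …, z_{n-1}]`, a real point `x` and a coordinate `i`,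
the univariate restriction `aeval (fun j => if j = i then X else C (x j)) q` (`= q(x with xᵢ := t)`
as a polynomial in `t`) is `0`, or every complex root `t` of its complexification has `Im t = 0`.
One line from `Literature.Combinatorics.StablePolynomials.IsRealStable.aeval_line_eq_zero_or_im_eq_zero`.
[cite: BorceaBranden2009, §1, Lemma 1.7 (1)] -/
theorem stub_realRootedRestriction :
    ∀ (n : ℕ) (q : MvPolynomial (Fin n) ℝ) (x : Fin n → ℝ) (i : Fin n),
      Literature.Combinatorics.StablePolynomials.IsRealStable q →
      MvPolynomial.aeval (fun j => if j = i then (Polynomial.X : Polynomial ℝ) else Polynomial.C (x j)) q = 0 ∨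
        ∀ t : ℂ, ((MvPolynomial.aeval (fun j => if j = i then (Polynomial.X : Polynomial ℝ) else Polynomial.C (x j)) q).map
            (algebraMap ℝ ℂ)).eval t = 0 → t.im = 0 :=
  fun _ _ x i hq =>
    Literature.Combinatorics.StablePolynomials.IsRealStable.aeval_line_eq_zero_or_im_eq_zero hq x i

end Summit.ValiantsHypothesis.ValiantsHypothesis.Theorems.DivisionGap.PerMultiplesHard.RealRootedRestriction

end
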